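import Literature.Analysis.FluidPDE.AxisymmetricLiftR5
import Literature.Analysis.FluidPDE.AxisymPoloidalPart
import HarnessLib

/-!
# Smooth radial quotients of axisymmetric scalars: `S = r² · (S/r²)` across the axis

Analysis/FluidPDE support file (definitions with bodies + proved API; no named facts) on the
decomposition path of the named fact
`Literature.Analysis.FluidPDE.LeiZhang2017_smallSwirl_regularity` (Lei–Zhang 2017, Thm. 1.4).
The a-priori estimates of Lei–Zhang (arXiv:1505.02628, §4) and of Hou–Li / Hou–Lei–Li are
written in the variables `u₁ = u^θ/r = Γ/r²`, `ω₁ = ω^θ/r`, `u^r/r`, `(1/r)∂ᵣ` of an axisymmetric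
flow, which are smooth functions on all of `ℝ³` although `r = cylRadius` is not (Liu–Wang 2006;
Hou–Li 2008, §2; KNSS 2009, Remark 5.1 for `ω_θ/r`). This file supplies that smoothness for a
general axisymmetric scalar `S` (`IsAxisymmetricScalar S`: `S (R_θ x) = S x`) by two explicit
Hadamard-type quotients, without any appeal to Whitney's even-function theorem:

* `scaleH s x = (s x₀, s x₁, x₂)` — scaling of the horizontal coordinates (the two-coordinate
  analogue of `scaleFst` of `HadamardQuotient.lean`), with its linear version `scaleHL s` and
  calculus;
* `radDerivQuot S = hadamardQuotFst (∂₀S)` — for an axisymmetric `S ∈ C²` this is the smooth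
  function `(∂ᵣS)/r`: `x₀ · radDerivQuot S x = ∂₀S x`, `x₁ · radDerivQuot S x = ∂₁S x`
  (`∂₀S` vanishes on `{x₀ = 0}` since `S` is even in `x₀`; the tangential derivative
  `DS(x)[Jx]` vanishes), hence `DS(x)[x_h] = r² radDerivQuot S x`;
* `radQuot S x = ∫₀¹ s · radDerivQuot S (scaleH s x) ds` — the smooth quotient `S/r²`:
  `r² · radQuot S x = S x − S (scaleH 0 x)` (fundamental theorem of calculus along
  `s ↦ S (scaleH s x)`, whose derivative is `s r² radDerivQuot S (scaleH s x)`), so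
  `r² · radQuot S = S` when `S` vanishes on the axis;
* smoothness `S ∈ Cⁿ⁺² ⇒ radDerivQuot S, radQuot S ∈ Cⁿ` (smooth dependence of parametric
  integrals, `Calculus.contDiff_intervalIntegral`), axisymmetry of both quotients, and sup
  bounds `|radDerivQuot S| ≤ sup ‖D∂₀S‖`, `|radQuot S| ≤ ½ sup ‖D∂₀S‖`,
  `‖D(radQuot S)‖ ≤ ½ sup ‖D(radDerivQuot S)‖`.

Applied to `Γ = swirl u`, `swirl (curl u)` and `x₀u₀ + x₁u₁` (all axisymmetric scalars vanishing
on the axis when `u` is axisymmetric) this gives the smooth Hou–Li variables `u^θ/r`, `ω^θ/r`,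
`u^r/r` (sibling files). All statements are folklore calculus (Hadamard's lemma).

## Mathlib / tree search

Tree: `hadamardQuotFst`, `smul_hadamardQuotFst`, `contDiff_hadamardQuotFst`,
`norm_hadamardQuotFst_le`, `scaleFst(L)` (`HadamardQuotient`); `IsEvenC`,
`IsAxisymmetricScalar.isEvenC_zero`, `IsEvenC.fderiv_single_zero_eq_zero`, `eq_of_eq_off_ker`
(`AxisymmetricLiftR5`); `fderiv_apply_rotGen_eq_zero_of_forall_rotZ` (`AxisymPoloidalPart`);
`Calculus.contDiff_intervalIntegral`, `Calculus.hasFDerivAt_intervalIntegral_partialFDerivFst`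
(`Calculus/HadamardLemma`). `lean search 'radQuot|radDerivQuot|scaleH'`: nothing before this
file. Mathlib has Hadamard-type lemmas only through Taylor (`taylor_mean_remainder`), nothing
for quotients by `x₀² + x₁²`.

## References

* Z. Lei, Q. S. Zhang, Pacific J. Math. 289 (2017) = arXiv:1505.02628, §1 (the variables
  `Ω = ω^θ/r`, `V = v^θ/√r`) and §4. [LeiZhang2017]
* T. Y. Hou, C. Li, Comm. Pure Appl. Math. 61 (2008) 661–697, §2 (the variables
  `u₁ = u^θ/r`, `ω₁ = ω^θ/r`, `ψ₁ = ψ^θ/r`); J.-G. Liu, W.-C. Wang, SIAM J. Math. Anal. 41 (2009)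
  (regularity of axisymmetric quantities across the axis).
* J. Milnor, *Morse theory* (1963), Lemma 2.1 (Hadamard's lemma). [folklore]
-/

noncomputable section

open MeasureTheory Set Function Filter Topology
open scoped ContDiff

namespace Literature.Analysis.FluidPDE

/-! ### Horizontal scaling -/

section ScaleH

/-- `scaleH s x = (s x₀, s x₁, x₂)`: scaling of the two horizontal coordinates of `x ∈ ℝ³`,
written without case analysis as `scaleFst s x − ((1 − s) x₁) e₁`. [folklore] -/
def scaleH (s : ℝ) (x : EuclideanSpace ℝ (Fin 3)) : EuclideanSpace ℝ (Fin 3) :=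
  scaleFst s x - ((1 - s) * x 1) • EuclideanSpace.single 1 1

/-- First coordinate: `(scaleH s x)₀ = s x₀`. [folklore] -/
@[simp] theorem scaleH_apply_zero (s : ℝ) (x : EuclideanSpace ℝ (Fin 3)) :
    scaleH s x 0 = s * x 0 := by
  simp [scaleH]

/-- Second coordinate: `(scaleH s x)₁ = s x₁`. [folklore] -/
@[simp] theorem scaleH_apply_one (s : ℝ) (x : EuclideanSpace ℝ (Fin 3)) :
    scaleH s x 1 = s * x 1 := by
  simp [scaleH]; ring

/-- Third coordinate unchanged: `(scaleH s x)₂ = x₂`. [folklore] -/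
@[simp] theorem scaleH_apply_two (s : ℝ) (x : EuclideanSpace ℝ (Fin 3)) :
    scaleH s x 2 = x 2 := by
  simp [scaleH]

/-- `scaleH 1 = id`. [folklore] -/
@[simp] theorem scaleH_one (x : EuclideanSpace ℝ (Fin 3)) : scaleH 1 x = x := by
  ext i
  fin_cases i <;> simp

/-- The radius scales: `r (scaleH s x) = s r(x)` for `s ≥ 0`. [folklore] -/
theorem cylRadius_scaleH {s : ℝ} (hs : 0 ≤ s) (x : EuclideanSpace ℝ (Fin 3)) :
    cylRadius (scaleH s x) = s * cylRadius x := by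
  unfold cylRadius
  rw [scaleH_apply_zero, scaleH_apply_one, mul_pow, mul_pow, ← mul_add,
    Real.sqrt_mul (sq_nonneg s), Real.sqrt_sq hs]

/-- `scaleH 0 x` lies on the axis. [folklore] -/
theorem cylRadius_scaleH_zero (x : EuclideanSpace ℝ (Fin 3)) : cylRadius (scaleH 0 x) = 0 := by
  rw [cylRadius_scaleH le_rfl, zero_mul]

/-- The horizontal scaling as a continuous linear map of `ℝ³`. [folklore] -/
def scaleHL (s : ℝ) : EuclideanSpace ℝ (Fin 3) →L[ℝ] EuclideanSpace ℝ (Fin 3) :=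
  scaleFstL s -
    ((1 - s) • ((ContinuousLinearMap.lsmul ℝ ℝ).flip
      (EuclideanSpace.single (1 : Fin 3) (1 : ℝ))).comp (EuclideanSpace.proj 1))

/-- `scaleHL s` is `scaleH s`. [folklore] -/
@[simp] theorem scaleHL_apply (s : ℝ) (x : EuclideanSpace ℝ (Fin 3)) :
    scaleHL s x = scaleH s x := by
  simp [scaleHL, scaleH, mul_smul]

/-- The horizontal scaling is a contraction for `s ∈ [0, 1]`: `‖scaleH s x‖ ≤ ‖x‖`. [folklore] -/
theorem norm_scaleH_le {s : ℝ} (hs : s ∈ Icc (0 : ℝ) 1) (x : EuclideanSpace ℝ (Fin 3)) :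
    ‖scaleH s x‖ ≤ ‖x‖ := by
  rw [EuclideanSpace.norm_eq, EuclideanSpace.norm_eq]
  refine Real.sqrt_le_sqrt ?_
  simp only [Fin.sum_univ_three, Real.norm_eq_abs, sq_abs, scaleH_apply_zero, scaleH_apply_one,
    scaleH_apply_two]
  have hs2 : s ^ 2 ≤ 1 := by nlinarith [hs.1, hs.2]
  have h1 : (s * x 0) ^ 2 ≤ x 0 ^ 2 := by
    rw [mul_pow]; nlinarith [sq_nonneg (x 0)]
  have h2 : (s * x 1) ^ 2 ≤ x 1 ^ 2 := by
    rw [mul_pow]; nlinarith [sq_nonneg (x 1)]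
  linarith

/-- Operator norm: `‖scaleHL s‖ ≤ 1` for `s ∈ [0, 1]`. [folklore] -/
theorem norm_scaleHL_le {s : ℝ} (hs : s ∈ Icc (0 : ℝ) 1) : ‖scaleHL s‖ ≤ 1 :=
  ContinuousLinearMap.opNorm_le_bound _ zero_le_one fun x => by
    rw [one_mul, scaleHL_apply]; exact norm_scaleH_le hs x

/-- The horizontal scaling is jointly smooth (polynomial) in `(x, s)`. [folklore] -/
theorem contDiff_scaleH_uncurry {n : WithTop ℕ∞} :
    ContDiff ℝ n fun p : EuclideanSpace ℝ (Fin 3) × ℝ => scaleH p.2 p.1 := by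
  unfold scaleH
  have h1 : ContDiff ℝ n fun p : EuclideanSpace ℝ (Fin 3) × ℝ => p.1 1 :=
    (contDiff_piLp_apply (p := 2) (n := n) (i := (1 : Fin 3))).comp contDiff_fst
  exact contDiff_scaleFst_uncurry.sub (((contDiff_const.sub contDiff_snd).mul h1).smul
    contDiff_const)

/-- Derivative in `s`: `d/ds scaleH s x = x₀ e₀ + x₁ e₁ = x_h`. [folklore] -/
theorem hasDerivAt_scaleH (x : EuclideanSpace ℝ (Fin 3)) (s : ℝ) :
    HasDerivAt (fun s => scaleH s x)
      ((x 0) • EuclideanSpace.single 0 1 + (x 1) • EuclideanSpace.single 1 1) s := by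
  unfold scaleH
  have h1 : HasDerivAt (fun s : ℝ => (1 - s) * x 1) (-(x 1)) s := by
    simpa using ((hasDerivAt_id s).const_sub 1).mul_const (x 1)
  have h2 := (hasDerivAt_scaleFst x s).sub
    (h1.smul_const (EuclideanSpace.single (1 : Fin 3) (1 : ℝ)))
  rw [neg_smul, sub_neg_eq_add] at h2
  exact h2

/-- Derivative in `x`: `D(scaleH s)(x) = scaleHL s`. [folklore] -/
theorem hasFDerivAt_scaleH (s : ℝ) (x : EuclideanSpace ℝ (Fin 3)) :
    HasFDerivAt (scaleH s) (scaleHL s) x := by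
  have h : scaleH s = fun x => scaleHL s x := funext fun x => (scaleHL_apply s x).symm
  rw [h]
  exact (scaleHL s).hasFDerivAt

/-- The horizontal scaling commutes with the rotations about the axis. [folklore] -/
theorem scaleH_rotZ (s θ : ℝ) (x : EuclideanSpace ℝ (Fin 3)) :
    scaleH s (rotZ θ x) = rotZ θ (scaleH s x) := by
  ext i
  fin_cases i
  · simp [rotZ_apply_zero]; ring
  · simp [rotZ_apply_one]; ring
  · simp [rotZ_apply_two]

end ScaleH


/-! ### The radial derivative quotient `(∂ᵣS)/r` -/

section RadDeriv

variable {S : EuclideanSpace ℝ (Fin 3) → ℝ}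

/-- **The smooth radial derivative quotient** `radDerivQuot S = hadamardQuotFst (∂₀S)`, i.e.
`∫₀¹ ∂₀∂₀S(τx₀, x₁, x₂) dτ`. For an axisymmetric scalar `S ∈ C²` this is the smooth function
which off the axis equals `(∂ᵣS)/r = ∂₀S/x₀ = ∂₁S/x₁` (Hou–Li's `(1/r)∂ᵣ`, half the first-order
part of `Δ₅` on `SO(4)`-invariant functions, KNSS 2009 p. 9). [folklore] -/
def radDerivQuot (S : EuclideanSpace ℝ (Fin 3) → ℝ) : EuclideanSpace ℝ (Fin 3) → ℝ :=
  hadamardQuotFst fun y => fderiv ℝ S y (EuclideanSpace.single 0 1)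

/-- The radial derivative quotient is `Cⁿ` for `S ∈ Cⁿ⁺²` (written `(n + 1) + 1`). [folklore] -/
theorem contDiff_radDerivQuot {n : ℕ∞} (hS : ContDiff ℝ ((n + 1 : ℕ∞) + 1) S) :
    ContDiff ℝ n (radDerivQuot S) :=
  contDiff_hadamardQuotFst (contDiff_fderiv_apply_const_succ (n := n + 1) hS _)

/-- The radial derivative quotient of a `C²` function is continuous. [folklore] -/
theorem continuous_radDerivQuot (hS : ContDiff ℝ 2 S) : Continuous (radDerivQuot S) :=
  (contDiff_radDerivQuot (n := 0) (by exact_mod_cast hS)).continuous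

/-- **`x₀ · (∂ᵣS/r) = ∂₀S`** everywhere, for an axisymmetric scalar `S ∈ C²`: `∂₀S` vanishes on
`{x₀ = 0}` (`S` is even in `x₀`), so Hadamard's lemma applies. [folklore] -/
theorem mul_radDerivQuot_eq_fderiv_zero (hS : ContDiff ℝ 2 S) (hax : IsAxisymmetricScalar S)
    (x : EuclideanSpace ℝ (Fin 3)) :
    x 0 * radDerivQuot S x = fderiv ℝ S x (EuclideanSpace.single 0 1) := by
  have h1 : ContDiff ℝ 1 (fun y => fderiv ℝ S y (EuclideanSpace.single 0 1)) :=
    contDiff_fderiv_apply_const_succ (n := 1) (by exact_mod_cast hS) _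
  have h0 : ∀ y : EuclideanSpace ℝ (Fin 3), y 0 = 0 →
      fderiv ℝ S y (EuclideanSpace.single 0 1) = 0 := fun y hy =>
    hax.isEvenC_zero.fderiv_single_zero_eq_zero (hS.differentiable two_ne_zero) hy
  have h := smul_hadamardQuotFst h1 h0 x
  rwa [smul_eq_mul] at h

/-- **`x₁ · (∂ᵣS/r) = ∂₁S`** everywhere, for an axisymmetric scalar `S ∈ C²`: off `{x₀ = 0}` this
follows from the previous identity and the vanishing of the tangential derivative
`DS(x)[Jx] = −x₁∂₀S + x₀∂₁S = 0`; both sides are continuous and `{x₀ ≠ 0}` is dense. [folklore] -/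
theorem mul_radDerivQuot_eq_fderiv_one (hS : ContDiff ℝ 2 S) (hax : IsAxisymmetricScalar S)
    (x : EuclideanSpace ℝ (Fin 3)) :
    x 1 * radDerivQuot S x = fderiv ℝ S x (EuclideanSpace.single 1 1) := by
  have hd : Differentiable ℝ S := hS.differentiable two_ne_zero
  have hc1 : Continuous fun y : EuclideanSpace ℝ (Fin 3) => y 1 * radDerivQuot S y :=
    ((contDiff_piLp_apply (𝕜 := ℝ) (p := 2) (n := 0) (i := (1 : Fin 3))).continuous).mul
      (continuous_radDerivQuot hS)
  have hc2 : Continuous fun y : EuclideanSpace ℝ (Fin 3) =>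
      fderiv ℝ S y (EuclideanSpace.single 1 1) :=
    (contDiff_fderiv_apply_const_succ (n := 1) (by exact_mod_cast hS) _).continuous
  refine eq_of_eq_off_ker (EuclideanSpace.proj (0 : Fin 3))
    ⟨EuclideanSpace.single 0 1, by simp⟩ hc1 hc2 (fun z hz => ?_) x
  have hz0 : z 0 ≠ 0 := by simpa using hz
  have htan := hax.fderiv_rotGen (hd z)
  rw [rotGen_eq_sub_single, map_sub, map_smul, map_smul, smul_eq_mul, smul_eq_mul,
    sub_eq_zero] at htan
  -- `htan : z 0 * ∂₁S z = z 1 * ∂₀S z`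
  have h0 := mul_radDerivQuot_eq_fderiv_zero hS hax z
  apply mul_left_cancel₀ hz0
  rw [htan, ← h0]
  ring

/-- **`DS(x)[x_h] = r² · (∂ᵣS/r)`** with `x_h = x₀e₀ + x₁e₁`, for an axisymmetric scalar
`S ∈ C²`. [folklore] -/
theorem fderiv_apply_horizontal_eq (hS : ContDiff ℝ 2 S) (hax : IsAxisymmetricScalar S)
    (x : EuclideanSpace ℝ (Fin 3)) :
    fderiv ℝ S x ((x 0) • EuclideanSpace.single 0 1 + (x 1) • EuclideanSpace.single 1 1) =
      cylRadius x ^ 2 * radDerivQuot S x := by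
  rw [map_add, map_smul, map_smul, smul_eq_mul, smul_eq_mul,
    ← mul_radDerivQuot_eq_fderiv_zero hS hax x, ← mul_radDerivQuot_eq_fderiv_one hS hax x,
    cylRadius_sq]
  ring

/-- Off the axis, `radDerivQuot S = ∂₀S/x₀`-free form: `radDerivQuot S x = DS(x)[x_h] / r²`.
[folklore] -/
theorem radDerivQuot_eq_div (hS : ContDiff ℝ 2 S) (hax : IsAxisymmetricScalar S)
    {x : EuclideanSpace ℝ (Fin 3)} (hx : cylRadius x ≠ 0) :
    radDerivQuot S x =
      fderiv ℝ S x ((x 0) • EuclideanSpace.single 0 1 + (x 1) • EuclideanSpace.single 1 1) /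
        cylRadius x ^ 2 := by
  rw [fderiv_apply_horizontal_eq hS hax, mul_div_cancel_left₀ _ (pow_ne_zero 2 hx)]

/-- The horizontal position vector is equivariant: `(R_θ x)_h = R_θ x_h`. [folklore] -/
theorem horizontal_rotZ (θ : ℝ) (x : EuclideanSpace ℝ (Fin 3)) :
    ((rotZ θ x 0) • EuclideanSpace.single 0 1 + (rotZ θ x 1) • EuclideanSpace.single 1 1 :
      EuclideanSpace ℝ (Fin 3)) =
      rotZ θ ((x 0) • EuclideanSpace.single 0 1 + (x 1) • EuclideanSpace.single 1 1) := by
  ext i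
  fin_cases i <;> simp [rotZ]

/-- Chain rule for an axisymmetric scalar: `DS(R_θ x)[R_θ v] = DS(x)[v]`. [folklore] -/
theorem IsAxisymmetricScalar.fderiv_rotZ_apply_rotZ (hax : IsAxisymmetricScalar S)
    (hd : Differentiable ℝ S) (θ : ℝ) (x v : EuclideanSpace ℝ (Fin 3)) :
    fderiv ℝ S (rotZ θ x) (rotZ θ v) = fderiv ℝ S x v := by
  have hcomp : (fun y => S (rotZL θ y)) = S := funext fun y => hax θ y
  have hl : HasFDerivAt (fun y => S (rotZL θ y)) ((fderiv ℝ S (rotZ θ x)).comp (rotZL θ)) x :=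
    (hd (rotZL θ x)).hasFDerivAt.comp x (rotZL θ).hasFDerivAt
  rw [hcomp] at hl
  rw [hl.fderiv, ContinuousLinearMap.comp_apply, rotZL_apply]

/-- **The radial derivative quotient of an axisymmetric scalar is an axisymmetric scalar**
(`S ∈ C²`): off `{x₀ = 0}` by `r² radDerivQuot S x = DS(x)[x_h]` and the chain rule, everywhere
by continuity. [folklore] -/
theorem isAxisymmetricScalar_radDerivQuot (hS : ContDiff ℝ 2 S) (hax : IsAxisymmetricScalar S) :
    IsAxisymmetricScalar (radDerivQuot S) := by
  intro θ x
  have hd : Differentiable ℝ S := hS.differentiable two_ne_zero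
  have hc : Continuous (radDerivQuot S) := continuous_radDerivQuot hS
  refine eq_of_eq_off_ker (EuclideanSpace.proj (0 : Fin 3)) ⟨EuclideanSpace.single 0 1, by simp⟩
    (hc.comp (rotZL θ).continuous) hc (fun z hz => ?_) x
  have hz0 : z 0 ≠ 0 := by simpa using hz
  have hr : cylRadius z ≠ 0 := fun h => hz0 ((cylRadius_eq_zero_iff z).1 h).1
  have hr' : cylRadius (rotZ θ z) ≠ 0 := by rwa [cylRadius_rotZ]
  show radDerivQuot S (rotZ θ z) = radDerivQuot S z
  rw [radDerivQuot_eq_div hS hax hr', radDerivQuot_eq_div hS hax hr, cylRadius_rotZ,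
    horizontal_rotZ, hax.fderiv_rotZ_apply_rotZ hd]

/-- **Sup bound**: `|radDerivQuot S x| ≤ B` whenever `‖D(∂₀S)‖ ≤ B` everywhere. [folklore] -/
theorem abs_radDerivQuot_le {B : ℝ}
    (hB : ∀ y, ‖fderiv ℝ (fun y => fderiv ℝ S y (EuclideanSpace.single 0 1)) y‖ ≤ B)
    (x : EuclideanSpace ℝ (Fin 3)) : |radDerivQuot S x| ≤ B := by
  rw [← Real.norm_eq_abs]
  exact norm_hadamardQuotFst_le hB x

end RadDeriv

/-! ### The radial quotient `S/r²` -/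

section RadQuot

variable {S : EuclideanSpace ℝ (Fin 3) → ℝ}

/-- **The smooth radial quotient** `radQuot S x = ∫₀¹ s · radDerivQuot S (scaleH s x) ds`. For an
axisymmetric scalar `S ∈ C²` vanishing on the axis this is the smooth function which off the
axis equals `S/r²` (`radQuot_eq_div`): e.g. `u^θ/r = Γ/r²` for `S = Γ = swirl u` (Hou–Li's `u₁`),
`ω^θ/r` for `S = swirl (curl u)` (Hou–Li's `ω₁`, Lei–Zhang's `Ω`), `u^r/r` for
`S = x₀u₀ + x₁u₁`. [folklore] -/
def radQuot (S : EuclideanSpace ℝ (Fin 3) → ℝ) (x : EuclideanSpace ℝ (Fin 3)) : ℝ :=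
  ∫ s in (0 : ℝ)..1, s * radDerivQuot S (scaleH s x)

/-- The integrand of the radial quotient is `Cⁿ` in `(x, s)` for `S ∈ Cⁿ⁺²`. [folklore] -/
theorem contDiff_radQuot_integrand {n : ℕ∞} (hS : ContDiff ℝ ((n + 1 : ℕ∞) + 1) S) :
    ContDiff ℝ n (uncurry fun (x : EuclideanSpace ℝ (Fin 3)) (s : ℝ) =>
      s * radDerivQuot S (scaleH s x)) :=
  contDiff_snd.mul ((contDiff_radDerivQuot hS).comp contDiff_scaleH_uncurry)

/-- **Smoothness of the radial quotient**: `S ∈ Cⁿ⁺² ⇒ radQuot S ∈ Cⁿ` (smooth dependence of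
parametric integrals; Liu–Wang / Hou–Li: `u^θ/r`, `ω^θ/r`, `ψ^θ/r` are smooth). [folklore] -/
theorem contDiff_radQuot {n : ℕ∞} (hS : ContDiff ℝ ((n + 1 : ℕ∞) + 1) S) :
    ContDiff ℝ n (radQuot S) :=
  Calculus.contDiff_intervalIntegral (contDiff_radQuot_integrand hS) 0 1

/-- The radial quotient of a `C²` function is continuous. [folklore] -/
theorem continuous_radQuot (hS : ContDiff ℝ 2 S) : Continuous (radQuot S) :=
  (contDiff_radQuot (n := 0) (by exact_mod_cast hS)).continuous

/-- `s ↦ scaleH s x` is continuous. [folklore] -/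
theorem continuous_scaleH_left (x : EuclideanSpace ℝ (Fin 3)) :
    Continuous fun s : ℝ => scaleH s x :=
  (contDiff_scaleH_uncurry (n := 0)).continuous.comp (continuous_const.prodMk continuous_id)

/-- **The derivative along the horizontal ray**: for an axisymmetric scalar `S ∈ C²`,
`d/ds S(scaleH s x) = s r² · radDerivQuot S (scaleH s x)` (chain rule and
`DS(y)[x_h] = x₀∂₀S(y) + x₁∂₁S(y) = (x₀y₀ + x₁y₁) radDerivQuot S y` at `y = scaleH s x`).
[folklore] -/
theorem hasDerivAt_comp_scaleH (hS : ContDiff ℝ 2 S) (hax : IsAxisymmetricScalar S)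
    (x : EuclideanSpace ℝ (Fin 3)) (s : ℝ) :
    HasDerivAt (fun s => S (scaleH s x))
      (s * cylRadius x ^ 2 * radDerivQuot S (scaleH s x)) s := by
  have h := ((hS.differentiable two_ne_zero) (scaleH s x)).hasFDerivAt.comp_hasDerivAt s
    (hasDerivAt_scaleH x s)
  have heq : fderiv ℝ S (scaleH s x)
      ((x 0) • EuclideanSpace.single 0 1 + (x 1) • EuclideanSpace.single 1 1) =
      s * cylRadius x ^ 2 * radDerivQuot S (scaleH s x) := by
    rw [map_add, map_smul, map_smul, smul_eq_mul, smul_eq_mul,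
      ← mul_radDerivQuot_eq_fderiv_zero hS hax, ← mul_radDerivQuot_eq_fderiv_one hS hax,
      scaleH_apply_zero, scaleH_apply_one, cylRadius_sq]
    ring
  rw [heq] at h
  exact h

/-- **Hadamard's lemma for the radial quotient**: `r² · radQuot S x = S x − S (scaleH 0 x)` for an
axisymmetric scalar `S ∈ C²` (fundamental theorem of calculus along `s ↦ S (scaleH s x)`).
[folklore] -/
theorem cylRadius_sq_mul_radQuot (hS : ContDiff ℝ 2 S) (hax : IsAxisymmetricScalar S)
    (x : EuclideanSpace ℝ (Fin 3)) :
    cylRadius x ^ 2 * radQuot S x = S x - S (scaleH 0 x) := by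
  have hd := hasDerivAt_comp_scaleH hS hax x
  have hcont : Continuous fun s : ℝ => s * cylRadius x ^ 2 * radDerivQuot S (scaleH s x) :=
    (continuous_id.mul continuous_const).mul
      ((continuous_radDerivQuot hS).comp (continuous_scaleH_left x))
  have hftc := intervalIntegral.integral_eq_sub_of_hasDerivAt (fun s _ => hd s)
    (hcont.intervalIntegrable 0 1)
  rw [scaleH_one] at hftc
  rw [radQuot, ← hftc, ← intervalIntegral.integral_const_mul]
  refine intervalIntegral.integral_congr fun s _ => ?_
  show cylRadius x ^ 2 * (s * radDerivQuot S (scaleH s x)) =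
    s * cylRadius x ^ 2 * radDerivQuot S (scaleH s x)
  rw [mul_comm s (cylRadius x ^ 2), mul_assoc]

/-- `r² · radQuot S = S` for an axisymmetric scalar `S ∈ C²` **vanishing on the axis** (as do
`swirl u`, `swirl (curl u)`, `x₀u₀ + x₁u₁`). [folklore] -/
theorem cylRadius_sq_mul_radQuot_of_axis (hS : ContDiff ℝ 2 S) (hax : IsAxisymmetricScalar S)
    (h0 : ∀ y, cylRadius y = 0 → S y = 0) (x : EuclideanSpace ℝ (Fin 3)) :
    cylRadius x ^ 2 * radQuot S x = S x := by
  rw [cylRadius_sq_mul_radQuot hS hax, h0 _ (cylRadius_scaleH_zero x), sub_zero]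

/-- Off the axis the radial quotient is `S/r²`. [folklore] -/
theorem radQuot_eq_div (hS : ContDiff ℝ 2 S) (hax : IsAxisymmetricScalar S)
    (h0 : ∀ y, cylRadius y = 0 → S y = 0) {x : EuclideanSpace ℝ (Fin 3)} (hx : cylRadius x ≠ 0) :
    radQuot S x = S x / cylRadius x ^ 2 := by
  rw [← cylRadius_sq_mul_radQuot_of_axis hS hax h0 x, mul_div_cancel_left₀ _ (pow_ne_zero 2 hx)]

/-- **The radial quotient of an axisymmetric scalar is an axisymmetric scalar** (`S ∈ C²`):
the integrand is, since `scaleH s` commutes with the rotations. [folklore] -/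
theorem isAxisymmetricScalar_radQuot (hS : ContDiff ℝ 2 S) (hax : IsAxisymmetricScalar S) :
    IsAxisymmetricScalar (radQuot S) := by
  intro θ x
  unfold radQuot
  refine intervalIntegral.integral_congr fun s _ => ?_
  show s * radDerivQuot S (scaleH s (rotZ θ x)) = s * radDerivQuot S (scaleH s x)
  rw [scaleH_rotZ, isAxisymmetricScalar_radDerivQuot hS hax θ]

/-- **Sup bound**: `|radQuot S x| ≤ B/2` whenever `|radDerivQuot S| ≤ B` everywhere
(`∫₀¹ s B ds = B/2`). [folklore] -/
theorem abs_radQuot_le {B : ℝ} (hB : ∀ y, |radDerivQuot S y| ≤ B) (x : EuclideanSpace ℝ (Fin 3)) :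
    |radQuot S x| ≤ B / 2 := by
  have hB0 : 0 ≤ B := (abs_nonneg _).trans (hB 0)
  have h := intervalIntegral.norm_integral_le_of_norm_le (μ := volume) (a := (0 : ℝ)) (b := 1)
    zero_le_one (f := fun s => s * radDerivQuot S (scaleH s x)) (g := fun s => s * B)
    (Eventually.of_forall fun s hs => ?_)
    ((continuous_id.mul continuous_const).intervalIntegrable 0 1)
  · rw [intervalIntegral.integral_mul_const, integral_id] at h
    rw [← Real.norm_eq_abs]
    calc ‖radQuot S x‖ = ‖∫ s in (0 : ℝ)..1, s * radDerivQuot S (scaleH s x)‖ := rfl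
      _ ≤ (1 ^ 2 - 0 ^ 2) / 2 * B := h
      _ = B / 2 := by ring
  · rw [Real.norm_eq_abs, abs_mul, abs_of_nonneg hs.1.le]
    exact mul_le_mul_of_nonneg_left (hB _) hs.1.le

/-! #### The derivative of the radial quotient -/

/-- **Differentiation under the integral sign for the radial quotient**: for `S ∈ C³`,
`D(radQuot S)(x) = ∫₀¹ s · D(radDerivQuot S)(scaleH s x) ∘ scaleHL s ds`. [folklore] -/
theorem hasFDerivAt_radQuot (hS : ContDiff ℝ 3 S) (x : EuclideanSpace ℝ (Fin 3)) :
    HasFDerivAt (radQuot S)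
      (∫ s in (0 : ℝ)..1, s • (fderiv ℝ (radDerivQuot S) (scaleH s x)).comp (scaleHL s)) x := by
  have hq : ContDiff ℝ 1 (radDerivQuot S) := contDiff_radDerivQuot (n := 1) (by exact_mod_cast hS)
  have hint : ContDiff ℝ 1 (uncurry fun (x : EuclideanSpace ℝ (Fin 3)) (s : ℝ) =>
      s * radDerivQuot S (scaleH s x)) :=
    contDiff_radQuot_integrand (n := 1) (by exact_mod_cast hS)
  have h := Calculus.hasFDerivAt_intervalIntegral_partialFDerivFst hint one_ne_zero 0 1 x
  have hpart : ∀ s, Calculus.partialFDerivFst (fun (x : EuclideanSpace ℝ (Fin 3)) (s : ℝ) =>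
      s * radDerivQuot S (scaleH s x)) x s =
      s • (fderiv ℝ (radDerivQuot S) (scaleH s x)).comp (scaleHL s) := by
    intro s
    rw [← Calculus.fderiv_eq_partialFDerivFst hint one_ne_zero x s]
    have hg : HasFDerivAt (fun y => radDerivQuot S (scaleH s y))
        ((fderiv ℝ (radDerivQuot S) (scaleH s x)).comp (scaleHL s)) x :=
      ((hq.differentiable one_ne_zero) _).hasFDerivAt.comp x (hasFDerivAt_scaleH s x)
    exact (hg.const_mul s).fderiv
  have heq : (∫ s in (0 : ℝ)..1, Calculus.partialFDerivFst
      (fun (x : EuclideanSpace ℝ (Fin 3)) (s : ℝ) => s * radDerivQuot S (scaleH s x)) x s) =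
      ∫ s in (0 : ℝ)..1, s • (fderiv ℝ (radDerivQuot S) (scaleH s x)).comp (scaleHL s) :=
    intervalIntegral.integral_congr fun s _ => hpart s
  rw [heq] at h
  exact h

/-- **Sup bound for the derivative of the radial quotient**: `‖D(radQuot S)(x)‖ ≤ B/2` if
`‖D(radDerivQuot S)‖ ≤ B` everywhere (`S ∈ C³`; `‖scaleHL s‖ ≤ 1` on `[0, 1]`). [folklore] -/
theorem norm_fderiv_radQuot_le (hS : ContDiff ℝ 3 S) {B : ℝ}
    (hB : ∀ y, ‖fderiv ℝ (radDerivQuot S) y‖ ≤ B) (x : EuclideanSpace ℝ (Fin 3)) :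
    ‖fderiv ℝ (radQuot S) x‖ ≤ B / 2 := by
  rw [(hasFDerivAt_radQuot hS x).fderiv]
  have hB0 : 0 ≤ B := (norm_nonneg _).trans (hB 0)
  have h := intervalIntegral.norm_integral_le_of_norm_le (μ := volume) (a := (0 : ℝ)) (b := 1)
    zero_le_one (f := fun s => s • (fderiv ℝ (radDerivQuot S) (scaleH s x)).comp (scaleHL s))
    (g := fun s => s * B) (Eventually.of_forall fun s hs => ?_)
    ((continuous_id.mul continuous_const).intervalIntegrable 0 1)
  · rw [intervalIntegral.integral_mul_const, integral_id] at h
    convert h using 1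
    ring
  · have hs' : s ∈ Icc (0 : ℝ) 1 := ⟨hs.1.le, hs.2⟩
    rw [norm_smul, Real.norm_eq_abs, abs_of_nonneg hs.1.le]
    refine mul_le_mul_of_nonneg_left ?_ hs.1.le
    calc ‖(fderiv ℝ (radDerivQuot S) (scaleH s x)).comp (scaleHL s)‖
        ≤ ‖fderiv ℝ (radDerivQuot S) (scaleH s x)‖ * ‖scaleHL s‖ :=
          ContinuousLinearMap.opNorm_comp_le _ _
      _ ≤ B * 1 := mul_le_mul (hB _) (norm_scaleHL_le hs') (norm_nonneg _) hB0
      _ = B := mul_one B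

end RadQuot



/-! ### The smooth Hou–Li variables of an axisymmetric vector field -/

section Fluid

variable {u : EuclideanSpace ℝ (Fin 3) → EuclideanSpace ℝ (Fin 3)}

/-- **`u^θ/r = Γ/r²` is smooth** (Hou–Li's `u₁`; Liu–Wang 2006): for an axisymmetric `u ∈ C²`,
`r² · radQuot (swirl u) = swirl u` everywhere. [folklore] -/
theorem IsAxisymmetric.cylRadius_sq_mul_radQuot_swirl (hax : IsAxisymmetric u) (hu : ContDiff ℝ 2 u)
    (x : EuclideanSpace ℝ (Fin 3)) : cylRadius x ^ 2 * radQuot (swirl u) x = swirl u x :=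
  cylRadius_sq_mul_radQuot_of_axis (contDiff_swirl hu) hax.isAxisymmetricScalar_swirl
    (fun _ hy => swirl_eq_zero_of_cylRadius_eq_zero u hy) x

/-- Off the axis, `radQuot (swirl u) = u^θ/r`. [folklore] -/
theorem IsAxisymmetric.radQuot_swirl_eq (hax : IsAxisymmetric u) (hu : ContDiff ℝ 2 u)
    {x : EuclideanSpace ℝ (Fin 3)} (hx : cylRadius x ≠ 0) :
    radQuot (swirl u) x = swirlVelocity u x / cylRadius x := by
  rw [radQuot_eq_div (contDiff_swirl hu) hax.isAxisymmetricScalar_swirl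
    (fun _ hy => swirl_eq_zero_of_cylRadius_eq_zero u hy) hx,
    swirl_eq_cylRadius_mul_swirlVelocity u hx, pow_two, mul_div_mul_left _ _ hx]

/-- **`ω^θ/r` is smooth** (Hou–Li's `ω₁`, Lei–Zhang's `Ω`; KNSS 2009, Remark 5.1): for an
axisymmetric `u ∈ C³`, `r² · radQuot (swirl (curl u)) = swirl (curl u)` (the swirl of the
vorticity, `r ω^θ`) everywhere. [folklore] -/
theorem IsAxisymmetric.cylRadius_sq_mul_radQuot_swirl_curl (hax : IsAxisymmetric u)
    (hu : ContDiff ℝ 3 u) (x : EuclideanSpace ℝ (Fin 3)) :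
    cylRadius x ^ 2 * radQuot (swirl (FluidPDE.curl u)) x = swirl (FluidPDE.curl u) x :=
  cylRadius_sq_mul_radQuot_of_axis (contDiff_swirl (contDiff_curl (n := 2) (by exact_mod_cast hu)))
    (hax.isAxisymmetricScalar_swirl_curl (hu.differentiable (by norm_num)))
    (fun _ hy => swirl_eq_zero_of_cylRadius_eq_zero _ hy) x

/-- Off the axis, `radQuot (swirl (FluidPDE.curl u)) = ω^θ/r`. [folklore] -/
theorem IsAxisymmetric.radQuot_swirl_curl_eq (hax : IsAxisymmetric u) (hu : ContDiff ℝ 3 u)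
    {x : EuclideanSpace ℝ (Fin 3)} (hx : cylRadius x ≠ 0) :
    radQuot (swirl (FluidPDE.curl u)) x = swirlVelocity (FluidPDE.curl u) x / cylRadius x := by
  rw [radQuot_eq_div (contDiff_swirl (contDiff_curl (n := 2) (by exact_mod_cast hu)))
    (hax.isAxisymmetricScalar_swirl_curl (hu.differentiable (by norm_num)))
    (fun _ hy => swirl_eq_zero_of_cylRadius_eq_zero _ hy) hx,
    swirl_eq_cylRadius_mul_swirlVelocity _ hx, pow_two, mul_div_mul_left _ _ hx]

/-- **The radial momentum `x₀u₀ + x₁u₁ = r u^r` of an axisymmetric field is an axisymmetric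
scalar.** [folklore] -/
theorem IsAxisymmetric.isAxisymmetricScalar_horizontal_inner (hax : IsAxisymmetric u) :
    IsAxisymmetricScalar fun x => x 0 * u x 0 + x 1 * u x 1 := by
  intro θ x
  simp only [hax θ x, rotZ_apply_zero, rotZ_apply_one]
  linear_combination (x 0 * u x 0 + x 1 * u x 1) * Real.sin_sq_add_cos_sq θ

/-- The radial momentum of a `Cⁿ` field is `Cⁿ`. [folklore] -/
theorem contDiff_horizontal_inner {n : WithTop ℕ∞} (hu : ContDiff ℝ n u) :
    ContDiff ℝ n fun x : EuclideanSpace ℝ (Fin 3) => x 0 * u x 0 + x 1 * u x 1 :=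
  ((contDiff_piLp_apply (𝕜 := ℝ) (p := 2) (n := n) (i := (0 : Fin 3))).mul
    ((contDiff_piLp_apply (𝕜 := ℝ) (p := 2) (n := n) (i := (0 : Fin 3))).comp hu)).add
    ((contDiff_piLp_apply (𝕜 := ℝ) (p := 2) (n := n) (i := (1 : Fin 3))).mul
      ((contDiff_piLp_apply (𝕜 := ℝ) (p := 2) (n := n) (i := (1 : Fin 3))).comp hu))

/-- **`u^r/r` is smooth**: for an axisymmetric `u ∈ C²`,
`r² · radQuot (x ↦ x₀u₀ + x₁u₁) = x₀u₀ + x₁u₁` everywhere. [folklore] -/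
theorem IsAxisymmetric.cylRadius_sq_mul_radQuot_horizontal_inner (hax : IsAxisymmetric u)
    (hu : ContDiff ℝ 2 u) (x : EuclideanSpace ℝ (Fin 3)) :
    cylRadius x ^ 2 * radQuot (fun x => x 0 * u x 0 + x 1 * u x 1) x = x 0 * u x 0 + x 1 * u x 1 :=
  cylRadius_sq_mul_radQuot_of_axis (contDiff_horizontal_inner hu)
    hax.isAxisymmetricScalar_horizontal_inner
    (fun y hy => by
      obtain ⟨h0, h1⟩ := (cylRadius_eq_zero_iff y).1 hy
      simp [h0, h1]) x

/-- Off the axis, `radQuot (x ↦ x₀u₀ + x₁u₁) = u^r/r` (`radialVelocity u = ⟪u, e_r⟫`). [folklore] -/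
theorem IsAxisymmetric.radQuot_horizontal_inner_eq (hax : IsAxisymmetric u) (hu : ContDiff ℝ 2 u)
    {x : EuclideanSpace ℝ (Fin 3)} (hx : cylRadius x ≠ 0) :
    radQuot (fun x => x 0 * u x 0 + x 1 * u x 1) x = radialVelocity u x / cylRadius x := by
  rw [radQuot_eq_div (contDiff_horizontal_inner hu) hax.isAxisymmetricScalar_horizontal_inner
    (fun y hy => by
      obtain ⟨h0, h1⟩ := (cylRadius_eq_zero_iff y).1 hy
      simp [h0, h1]) hx]
  have hr : radialVelocity u x = (x 0 * u x 0 + x 1 * u x 1) / cylRadius x := by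
    simp only [radialVelocity, eR, inner_smul_right, PiLp.inner_apply, RCLike.inner_apply,
      conj_trivial, Fin.sum_univ_three, Matrix.cons_val_zero, Matrix.cons_val_one,
      Matrix.cons_val_two, Matrix.head_cons, Matrix.tail_cons]
    rw [div_eq_inv_mul]
    ring
  rw [hr, div_div, ← pow_two]

end Fluid

end Literature.Analysis.FluidPDE

end
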